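import Mathlib
import HarnessLib
import Summits.NavierStokesRegularity.NavierStokesRegularity.Theses.SymmetryModuliCount
import Literature.Analysis.FluidPDE.VectorCalculus
import Literature.Analysis.FluidPDE.WeakSolution
import Literature.Analysis.FluidPDE.SelfSimilar

/-!
# Sketch — crux-ideate stmt-NavierStokesRegularity-4054 (`LinearLiouvilleSeven`), round 1, ideator 3

First lemmas (signatures only, no proofs claimed) for the two crux idea cards

* `noether-charge-subsolutions` — the Noether charge densities of the similarity group obey
  drift–heat equations sourced by the JACOBI PRESSURES of the crux's seven Jacobi fields; the
  dilation charge `π = (−t)(p + ½|u|²) + ½ x·u` has the dissipative sign: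
  `(∂ₜ − Δ + u·∇) π = −(−t)|ω|² − ½ q_σ`, `q_σ = 2p + x·∇p + 2t ∂ₜp` (scaling Jacobi pressure).
* `radial-vorticity-moment` — the radial Mie scalar of the vorticity obeys the pressure-free
  identity `(∂ₜ − Δ + u·∇)(x·ω) = (ω·∇)(x·u)`; toroidal Type-I ancient solutions vanish.

Everything is stated over existing declarations: `Literature.Analysis.FluidPDE.{timeDeriv, convect,
curl, cross, VectorCalculus.IsDivFree, VectorCalculus.divergence, heatFlow, oseenKernel,
HasTypeITimeDecay}`, Mathlib `gradient`, `Laplacian.laplacian`, `fderiv`,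
`LinearMap.trace`, and the route decls
`Summit.NavierStokesRegularity.NavierStokesRegularity.Theses.SymmetryModuliCount.{LinearLiouvilleSeven,
TypeIAncientLiouville}`.
-/

namespace Summit.NavierStokesRegularity.NavierStokesRegularity.Cruxes.LinearLiouvilleSeven.Ideator3

open scoped InnerProductSpace
open Literature.Analysis.FluidPDE

local notation "ℝ³" => EuclideanSpace ℝ (Fin 3)

/-! ## Common vocabulary -/

/-- The route's class `A_C` (verbatim the crux's hypothesis clause on `u`). -/
def InClassA (C : ℝ) (u : ℝ → ℝ³ → ℝ³) : Prop :=
  ContDiffOn ℝ (⊤ : ℕ∞) (Function.uncurry u) (Set.Iio 0 ×ˢ Set.univ) ∧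
  (∀ t < 0, VectorCalculus.IsDivFree (u t)) ∧
  (∀ s t : ℝ, s < t → t < 0 → ∀ x, u t x = heatFlow (u s) (t - s) x -
      ∫ τ in Set.Ioo s t, ∫ y, oseenKernel (t - τ) (x - y) (u τ y) (u τ y)) ∧
  HasTypeITimeDecay C u

/-- `(u, p)` is a smooth classical Navier–Stokes pair (ν = 1, no force) on the open past
`(−∞,0) × ℝ³`, together with the pressure–Poisson equation `Δp = −tr((∇u)²)` (a consequence of
the momentum equation and `div u = 0`, recorded as a clause so that the identities below are
pointwise algebra). -/
def IsClassicalPastPair (u : ℝ → ℝ³ → ℝ³) (p : ℝ → ℝ³ → ℝ) : Prop :=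
  ContDiffOn ℝ (⊤ : ℕ∞) (Function.uncurry u) (Set.Iio 0 ×ˢ Set.univ) ∧
  ContDiffOn ℝ (⊤ : ℕ∞) (Function.uncurry p) (Set.Iio 0 ×ˢ Set.univ) ∧
  (∀ t < 0, VectorCalculus.IsDivFree (u t)) ∧
  (∀ t < 0, ∀ x, timeDeriv u t x + convect (u t) (u t) x =
      Laplacian.laplacian (u t) x - gradient (p t) x) ∧
  (∀ t < 0, ∀ x, Laplacian.laplacian (p t) x =
      - LinearMap.trace ℝ ℝ³ ((fderiv ℝ (u t) x : ℝ³ →ₗ[ℝ] ℝ³) ∘ₗ (fderiv ℝ (u t) x : ℝ³ →ₗ[ℝ] ℝ³)))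

/-- The drift–heat operator `(∂ₜ − Δ + u·∇) f` on a scalar space–time field `f`. -/
noncomputable def driftHeat (u : ℝ → ℝ³ → ℝ³) (f : ℝ → ℝ³ → ℝ) (t : ℝ) (x : ℝ³) : ℝ :=
  timeDeriv f t x - Laplacian.laplacian (f t) x + fderiv ℝ (f t) x (u t x)

/-! ## Card `noether-charge-subsolutions` -/

/-- The DILATION CHARGE (virial/head density in the backward similarity gauge centred at the
space–time origin): `π(t,x) = (−t)(p + ½|u|²) + ½ x·u`.  In Leray variables it is Tsai's head
pressure `P + ½|U|² + ½ y·U` (tree: `TsaiProfileEndgame`, `headPressure`, rate `a = ½`). -/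
noncomputable def dilationCharge (u : ℝ → ℝ³ → ℝ³) (p : ℝ → ℝ³ → ℝ) (t : ℝ) (x : ℝ³) : ℝ :=
  (-t) * (p t x + ‖u t x‖ ^ 2 / 2) + ⟪x, u t x⟫_ℝ / 2

/-- The SCALING JACOBI PRESSURE `q_σ = 2p + x·∇p + 2t ∂ₜp` — the pressure of the scaling Jacobi
field `v_σ = u + x·∇u + 2t∂ₜu` (route support `JacobiFieldsTempered`, stmt-4057, σ-component). -/
noncomputable def scalingPressure (p : ℝ → ℝ³ → ℝ) (t : ℝ) (x : ℝ³) : ℝ :=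
  2 * p t x + fderiv ℝ (p t) x x + 2 * t * timeDeriv p t x

/-- The ROTATION JACOBI PRESSURE `q_A = (a × x)·∇p` (pressure of the rotation Jacobi field about the
axis `a` through the origin) and the TRANSLATION JACOBI PRESSURE `q_a = a·∇p`. -/
noncomputable def rotationPressure (a : ℝ³) (p : ℝ → ℝ³ → ℝ) (t : ℝ) (x : ℝ³) : ℝ :=
  fderiv ℝ (p t) x (cross a x)

noncomputable def translationPressure (a : ℝ³) (p : ℝ → ℝ³ → ℝ) (t : ℝ) (x : ℝ³) : ℝ :=
  fderiv ℝ (p t) x a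

/-- **First lemma (S), DILATION CHARGE IDENTITY.** For every smooth classical Navier–Stokes pair on
the past, `(∂ₜ − Δ + u·∇) π = −(−t)|curl u|² − ½ q_σ` pointwise: the dilation charge is an exact
drift–heat SUBSOLUTION up to the scaling Jacobi pressure (`q_σ ≡ 0` iff `p` is backward
self-similar about `(0,0)`, and then this is Tsai 1998 (1.7) / NRŠ 1996 (2.9) read in physical
variables).  Size S–M (pure calculus; sympy-verified, kit job on the card). -/
def DilationChargeIdentity : Prop :=
  ∀ (u : ℝ → ℝ³ → ℝ³) (p : ℝ → ℝ³ → ℝ), IsClassicalPastPair u p →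
    ∀ t < 0, ∀ x, driftHeat u (dilationCharge u p) t x =
      -((-t) * ‖curl (u t) x‖ ^ 2) - scalingPressure p t x / 2

/-- **(R) and (T), ROTATION AND TRANSLATION CHARGE IDENTITIES** (classical angular/linear momentum
balances written as drift–heat equations): `(∂ₜ − Δ + u·∇)((a×x)·u) = −q_A − 2 a·curl u` and
`(∂ₜ − Δ + u·∇)(a·u) = −q_a`.  With (S) these are the seven Noether charge identities of `sim(3)`. -/
def RotationTranslationChargeIdentities : Prop :=
  ∀ (u : ℝ → ℝ³ → ℝ³) (p : ℝ → ℝ³ → ℝ), IsClassicalPastPair u p → ∀ (a : ℝ³), ∀ t < 0, ∀ x,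
    driftHeat u (fun s y => ⟪cross a y, u s y⟫_ℝ) t x =
        -(rotationPressure a p t x) - 2 * ⟪a, curl (u t) x⟫_ℝ ∧
    driftHeat u (fun s y => ⟪a, u s y⟫_ℝ) t x = -(translationPressure a p t x)

/-- **ANTI-BERNOULLI INEQUALITY (the max-principle half of the line, size M).** If `u ∈ A_C` has a
classical pressure with the KNSS gauge bounds and the scaling Jacobi pressure about the origin is
dominated by the dissipation, `q_σ ≤ 2(−t)|curl u|²` (so `π` is a global drift–heat subsolution),
then `π ≤ 0` on the whole past: `(−t)(p + ½|u|²) + ½ x·u ≤ 0`.  Proof plan: Tsai's quadratic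
barrier `ε|y|²` against Leray's exploding drift `U + y/2` in similarity variables (tree:
`TsaiMaximumPrinciple`, `isConst_of_driftOp_nonneg_of_poly`, parabolic version), KNSS
compactness of `A_C` under the scaling flow, strong maximum principle on the limit element, and
`curl ≡ 0 ∧ bounded ∧ div-free ∧ KNSS-mild ⇒ 0`. -/
def AntiBernoulliOfDilationSubsolution : Prop :=
  ∀ (C C₁ C₃ : ℝ) (u : ℝ → ℝ³ → ℝ³) (p : ℝ → ℝ³ → ℝ), InClassA C u → IsClassicalPastPair u p →
    (∀ t < 0, ∀ x, ‖fderiv ℝ (u t) x‖ ≤ C₁ / (-t)) →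
    (∀ t < 0, ∀ x, |p t x| ≤ C₃ * (1 + ‖x‖ / Real.sqrt (-t)) / (-t) ∧
      ‖gradient (p t) x‖ ≤ C₃ / Real.sqrt (-t) ^ 3) →
    (∀ t < 0, ∀ x, scalingPressure p t x ≤ 2 * ((-t) * ‖curl (u t) x‖ ^ 2)) →
    ∀ t < 0, ∀ x, dilationCharge u p t x ≤ 0

/-- **SLAB SELF-SIMILAR RIGIDITY (size M; the exact "calm" case, on-lever: `q_σ` is the pressure of
`v_σ`).** If `u ∈ A_C` is scale-stationary about ONE centre `x₀` on ONE log-unit time slab — its scaling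
Jacobi field `v_σ = u + (x−x₀)·∇u + 2t∂ₜu` vanishes on `[eT, T] × ℝ³` — then `u ≡ 0` on the whole past.
Plan: on the slab `u = (−t)^{−1/2} U((x−x₀)/√(−t))` with `U` a bounded smooth Leray profile (rate ½), so
`U` is constant by `tsai_selfsimilar_bounded_holds`; a slice-constant KNSS-mild field is `0`; forward
uniqueness of bounded mild solutions gives `u ≡ 0` on `[T, 0)`, and ESS backward uniqueness applied to
the VORTICITY equation (local in `ω`, bounded coefficients `u, ∇u`; tree
`Carleman.backwardUniqueness_uncurried` / `ess_backward_uniqueness_C1`) plus `curl ≡ 0 ∧ bounded ⇒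
slice-constant ⇒ 0` gives `u ≡ 0` before `eT`.  (A Cesàro-averaged hypothesis uniform in the centre is
also sufficient but for a cheaper reason — it forces `(−t)‖∇u‖_∞ → 0` in log-time mean, and the
Duhamel formula from `t = −∞` finishes; recorded in NOTES, not typed.) -/
def SlabSelfSimilarRigidity : Prop :=
  ∀ (C : ℝ) (x₀ : ℝ³) (T : ℝ) (u : ℝ → ℝ³ → ℝ³), InClassA C u → T < 0 →
    (∀ t ∈ Set.Icc (Real.exp 1 * T) T, ∀ x,
        u t x + fderiv ℝ (u t) x (x - x₀) + (2 * t) • timeDeriv u t x = 0) →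
    ∀ t < 0, ∀ x, u t x = 0

/-- How the line concludes the crux BY NAME: the curried form of the disprover's
`Cruxes.LinearLiouvilleSeven.Disproof.linearLiouvilleSeven_of_typeI_of_atZero` (X → AtZero → LL7,
Disproof.lean cycle 1) once the lead's anchor `AtZero` is supplied; recorded as an implication shape
only; `TypeIAncientLiouville` is the route target stmt-4050. -/
def LineShape : Prop :=
  Summit.NavierStokesRegularity.NavierStokesRegularity.Theses.SymmetryModuliCount.TypeIAncientLiouville →
  Summit.NavierStokesRegularity.NavierStokesRegularity.Theses.SymmetryModuliCount.LinearLiouvilleSeven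

/-! ## Card `radial-vorticity-moment` -/

/-- **First lemma (V), RADIAL VORTICITY IDENTITY.** For every smooth classical Navier–Stokes pair on
the past and every centre `x₀`, the radial Mie scalar of the vorticity obeys the PRESSURE-FREE
drift–heat equation `(∂ₜ − Δ + u·∇)((x−x₀)·ω) = (ω·∇)((x−x₀)·u)`, `ω = curl u`: no stretching
potential survives, only the derivative of the radial velocity moment along vortex lines
(Bullard–Gellman's toroidal mechanism, in physical variables, any centre).  Size S–M. -/
def RadialVorticityIdentity : Prop :=
  ∀ (u : ℝ → ℝ³ → ℝ³) (p : ℝ → ℝ³ → ℝ), IsClassicalPastPair u p → ∀ (x₀ : ℝ³), ∀ t < 0, ∀ x,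
    driftHeat u (fun s y => ⟪y - x₀, curl (u s) y⟫_ℝ) t x =
      fderiv ℝ (fun y => ⟪y - x₀, u t y⟫_ℝ) x (curl (u t) x)

/-- **TOROIDAL ANCIENT LIOUVILLE (size M; a solvable NON-symmetric leaf).** A smooth ancient
Navier–Stokes solution on `(−∞,0) × ℝ³` with the Type-I bounds `√(−t)|u| ≤ C`, `(−t)|curl u| ≤ C₁`
that is tangent to the spheres about one point, `(x − x₀)·u ≡ 0`, is identically zero.  (Mildness
is not even needed: by (V) the scalar `Φ = (x−x₀)·ω` solves the sourceless drift–heat equation, in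
similarity variables with damping `½`; the Gaussian-barrier comparison kills it; a field tangent to
spheres with tangent curl is zero sphere by sphere, `H¹(S²) = 0`.) -/
def ToroidalAncientLiouville : Prop :=
  ∀ (C C₁ : ℝ) (x₀ : ℝ³) (u : ℝ → ℝ³ → ℝ³) (p : ℝ → ℝ³ → ℝ), IsClassicalPastPair u p →
    HasTypeITimeDecay C u → (∀ t < 0, ∀ x, (-t) * ‖curl (u t) x‖ ≤ C₁) →
    (∀ t < 0, ∀ x, ⟪x - x₀, u t x⟫_ℝ = 0) →
    ∀ t < 0, ∀ x, u t x = 0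

/-- **RADIAL SLAVING (size M).** In the same class, the radial vorticity moment is slaved to the
radial velocity moment with an explicit constant: `sup √(−t)|(x−x₀)·curl u| ≤ 2 C₁ sup √(−t)|∇((x−x₀)·u)|`
(damped drift–heat equation (V) in similarity variables, maximum principle in the Tychonoff class);
with the spherical Hodge decomposition this bounds `u` itself by its radial moment about ONE centre. -/
def RadialSlaving : Prop :=
  ∀ (C C₁ M : ℝ) (x₀ : ℝ³) (u : ℝ → ℝ³ → ℝ³) (p : ℝ → ℝ³ → ℝ), IsClassicalPastPair u p →
    HasTypeITimeDecay C u → (∀ t < 0, ∀ x, (-t) * ‖curl (u t) x‖ ≤ C₁) →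
    (∀ t < 0, ∀ x, Real.sqrt (-t) * ‖fderiv ℝ (fun y => ⟪y - x₀, u t y⟫_ℝ) x‖ ≤ M) →
    ∀ t < 0, ∀ x, Real.sqrt (-t) * |⟪x - x₀, curl (u t) x⟫_ℝ| ≤ 2 * C₁ * M

end Summit.NavierStokesRegularity.NavierStokesRegularity.Cruxes.LinearLiouvilleSeven.Ideator3
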